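import Literature.AlgebraicGeometry.Motives.HodgeLieWeightOneIdealPair
import HarnessLib

/-!
# Weight-one Hodge structures whose Hodge Lie algebra contains a three-dimensional IDEAL `𝔞` with a commuting
# complement `𝔟`.  B: the `𝔞`-component of the Hodge operator is `α⁻¹[E, F]`, and the projector `π = α⁻¹(EF + FE)`
# onto the part of `V` moved by `𝔞`

Family `hodge`, layer `Literature/AlgebraicGeometry/Motives`; THEOREMS ONLY (no definition, no named fact; D-0026).
Second abstract file of the lane MT-RANK-SEVEN-SPLIT of the cell `pub-hodgecm2` (COR-CM), seat `b27` (setting as in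
`Motives/HodgeLieWeightOneIdealPair`: polarizable weight-one `H` with polarization `ψ`, graded basis `e` with degrees in
`{0,1}`, `P = gradingEnd e deg`, `𝔥 = Lie Hg(H)`, an ideal `𝔞 ≤ 𝔥` of dimension `3`, `X ∈ 𝔞 ∖ End_Hdg(V)`,
`E = P X_ℂ (1 − P)`, `F = (1 − P) X_ℂ P`, so that `𝔞_ℂ = ℂE ⊕ ℂF ⊕ ℂ[E, F]`); here moreover `𝔟` is a rational subspace
COMMUTING elementwise with `𝔞` and with `𝔥 ≤ 𝔞 + 𝔟` (e.g. a complementary ideal of a semisimple `𝔥`, or the centre).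

* §3 `exists_ideal_component` — **the `𝔞`-component of the Hodge operator**: `2P − 1 = α⁻¹[E, F] + B` with `B ∈ 𝔟_ℂ`,
  `α ≠ 0`, `E F E = αE`, `F E F = αF`.  PROOF: `2P − 1 ∈ 𝔥_ℂ ⊆ 𝔞_ℂ + 𝔟_ℂ`, write it `A + B`; `𝔟_ℂ` commutes with
  `E, F ∈ 𝔞_ℂ`, so `[A, E] = [2P − 1, E] = 2E` and `[A, F] = −2F`; with `A = c₀E + c₁F + c₂[E,F]` and `E² = F² = 0` the
  `(1−P)`-corners give `c₀ = c₁ = 0` (`F E ≠ 0`, second Hodge–Riemann relation) and then `c₂ EFE = E`, `c₂ FEF = F` —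
  the weight-one shortcut replacing the Casimir / string analysis of an `𝔰𝔩₂ × 𝔰𝔩₂`-module: in `V_ℂ ≅ ⊕ V(a) ⊠ W_a`
  only `a = 1` occurs for the `𝔰𝔩₂`-triple `(α⁻¹[E,F], E, α⁻¹F)`.
* §4 `idealProjector_identities` — for `π = α⁻¹(EF + FE)`: `π² = π`, `Pπ = πP = α⁻¹EF`, `Eπ = E = πE`, `Fπ = F = πF`,
  `(2P − 1)π = α⁻¹[E, F]`, `π` commutes with `2P − 1`, the off-diagonal blocks of `π` vanish (`π` is of type `(0,0)`);
  `mul_idealProjector_of_mem_spanC` — **`Dπ = D = πD` for every `D ∈ 𝔞_ℂ`**; `sq_eq_smul_idealProjector` — **`D² ∈ ℂπ`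
  for `D ∈ 𝔞_ℂ`** (`D = aE + bF + c[E,F]` has `D² = α(ab + αc²)π`); `exists_mul_ne_mul_of_ideal` — an ideal of `𝔥` not
  inside `End_Hdg(V)` is not commutative (basis-free).

The sequel `Motives/HodgeLieWeightOneIdealPairSplitting` runs this for both members of a pair `(𝔞, 𝔟)` of
three-dimensional ideals (`π_𝔞 + π_𝔟 = 1`, `𝔟_ℂ π_𝔞 = 0`) and descends `π_𝔞` to a rational central Hodge idempotent.
Classically (Moonen–Zarhin 1999 §3 (3.1), Cor. (3.7) after Imai; Deligne LNM 900 I §3): `Hg = Hg₁ × Hg₂` with `Hgᵢ` forms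
of `SL₂` and `V = V₁ ⊕ V₂`, `Hgᵢ` acting on `Vᵢ` through the standard representation.

## References

* [MoonenZarhin1999LowDim] B. Moonen, Yu. Zarhin, *Hodge classes on abelian varieties of low dimension*, Math. Ann. 315
  (1999), §2 (Hodge group, reductivity, `End⁰(X) = End_{Hg} H¹`), §3 (3.1) and Cor. (3.7).
* [Deligne1982HodgeCycles] P. Deligne, *Hodge cycles on abelian varieties*, LNM 900 (1982), I §3 (3.1–3.6).
* [FultonHarris1991] W. Fulton, J. Harris, *Representation Theory*, GTM 129 (1991), Lecture 11 (§11.1), §9.3.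
-/

noncomputable section

open scoped TensorProduct

namespace Literature.AlgebraicGeometry.Motives

universe u

namespace HodgeStructure

open ProjectorBlocks Literature.RepresentationTheory.GeneralLinear

variable {V : Type u} [AddCommGroup V] [Module ℚ V] [Module.Finite ℚ V] [HodgeTensorFacts.{u, u}] {n : ℤ}
  {S : Type u} [Fintype S] [DecidableEq S] {deg : S → ℤ}

/-! ## §3 The `𝔞`-component of the Hodge operator `2P − 1` -/

/-- **The `𝔞`-component of the Hodge operator.**  Let `𝔞 ≤ 𝔥` be a three-dimensional ideal, `𝔟` a rational subspace
commuting elementwise with `𝔞` with `𝔥 ≤ 𝔞 + 𝔟`, `X ∈ 𝔞 ∖ End_Hdg(V)` (weight `1`, degrees in `{0,1}`, `ψ` a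
polarization).  Then there are `α ≠ 0` and `B ∈ 𝔟_ℂ` with **`E F E = αE`, `F E F = αF` and `2P − 1 = α⁻¹[E, F] + B`**.
PROOF: `2P − 1 ∈ 𝔥_ℂ ⊆ 𝔞_ℂ + 𝔟_ℂ`, say `= A + B`; `B` commutes with `E, F ∈ 𝔞_ℂ`, so `[A, E] = [2P−1, E] = 2E`,
`[A, F] = −2F`; with `A = c₀E + c₁F + c₂[E,F]`, `E² = F² = 0`: the `(1−P)`-corners of the two identities are
`−c₁FE = 0`, `−c₀FE = 0` (`FE ≠ 0`), and what is left is `2c₂EFE = 2E`, `−2c₂FEF = −2F`; `α = c₂⁻¹`.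
[cite: MoonenZarhin1999LowDim, §2 and §3 (3.1)] [cite: Deligne1982HodgeCycles, I §3 (3.1–3.6)]
[cite: FultonHarris1991, Lecture 11 (§11.1)] -/
theorem exists_ideal_component (H : HodgeStructure V n) (ψ : H.Polarization) (hn : n = 1)
    (e : Module.Basis S ℂ (ℂ ⊗[ℚ] V)) (hF : ∀ a, H.F a = Submodule.span ℂ (e '' {σ | a ≤ deg σ}))
    (hFc : ∀ a, complexConj (H.F a) = Submodule.span ℂ (e '' {σ | deg σ ≤ n - a}))
    (hdeg : ∀ σ, deg σ = 0 ∨ deg σ = 1) {𝔞 𝔟 : Submodule ℚ (Module.End ℚ V)} (h𝔞 : 𝔞 ≤ H.hodgeLie)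
    (hI : ∀ Z ∈ H.hodgeLie, ∀ X ∈ 𝔞, Z * X - X * Z ∈ 𝔞) (h3 : Module.finrank ℚ 𝔞 = 3)
    (hcomm : ∀ X ∈ 𝔞, ∀ Y ∈ 𝔟, X * Y = Y * X) (hsum : H.hodgeLie ≤ 𝔞 ⊔ 𝔟)
    {X : Module.End ℚ V} (hX : X ∈ 𝔞) (hXE : X ∉ H.endAlg) :
    ∃ (α : ℂ) (B : Module.End ℂ (ℂ ⊗[ℚ] V)), α ≠ 0 ∧ B ∈ spanC 𝔟 ∧
      (gradingEnd e deg * X.baseChange ℂ * (1 - gradingEnd e deg)) *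
          ((1 - gradingEnd e deg) * X.baseChange ℂ * gradingEnd e deg) *
          (gradingEnd e deg * X.baseChange ℂ * (1 - gradingEnd e deg)) =
        α • (gradingEnd e deg * X.baseChange ℂ * (1 - gradingEnd e deg)) ∧
      ((1 - gradingEnd e deg) * X.baseChange ℂ * gradingEnd e deg) *
          (gradingEnd e deg * X.baseChange ℂ * (1 - gradingEnd e deg)) *
          ((1 - gradingEnd e deg) * X.baseChange ℂ * gradingEnd e deg) =
        α • ((1 - gradingEnd e deg) * X.baseChange ℂ * gradingEnd e deg) ∧
      (2 : ℂ) • gradingEnd e deg - 1 =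
        α⁻¹ • ((gradingEnd e deg * X.baseChange ℂ * (1 - gradingEnd e deg)) *
            ((1 - gradingEnd e deg) * X.baseChange ℂ * gradingEnd e deg) -
          ((1 - gradingEnd e deg) * X.baseChange ℂ * gradingEnd e deg) *
            (gradingEnd e deg * X.baseChange ℂ * (1 - gradingEnd e deg))) + B := by
  classical
  subst hn
  have hX𝔥 : X ∈ H.hodgeLie := h𝔞 hX
  have hFE0 := projF_mul_projE_ne_zero H ψ rfl e hF hFc hdeg hX𝔥 hXE
  obtain ⟨hE0, hF0⟩ := projE_ne_zero_of_not_mem_endAlg H rfl e hF hFc hdeg hXE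
  obtain ⟨hEd, hFd⟩ := projE_mem_spanC_of_ideal H rfl e hF hFc hdeg hI hX
  set P := gradingEnd e deg with hP
  set Y := X.baseChange ℂ with hY
  set E := P * Y * (1 - P) with hEdef
  set F := (1 - P) * Y * P with hFdef
  have hPP : P * P = P := gradingEnd_mul_gradingEnd_of_deg e hdeg
  have hPE : P * E = E := by rw [hEdef, ← mul_assoc, ← mul_assoc, hPP]
  have hEP : E * P = 0 := by rw [hEdef, mul_assoc (P * Y) (1 - P) P, sub_mul, one_mul, hPP, sub_self, mul_zero]
  have hPF : P * F = 0 := by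
    rw [hFdef, mul_assoc (1 - P) Y P, ← mul_assoc P (1 - P) (Y * P), mul_sub, mul_one, hPP, sub_self, zero_mul]
  have hFP : F * P = F := by rw [hFdef, mul_assoc ((1 - P) * Y) P P, hPP]
  have hEQ : E * (1 - P) = E := by rw [mul_sub, mul_one, hEP, sub_zero]
  have hQF : (1 - P) * F = F := by rw [sub_mul, one_mul, hPF, sub_zero]
  have hQE : (1 - P) * E = 0 := by rw [sub_mul, one_mul, hPE, sub_self]
  have hFQ : F * (1 - P) = 0 := by rw [mul_sub, mul_one, hFP, sub_self]
  obtain ⟨hEE, hFF⟩ := SL2Triple.mul_self_eq_zero hPE hEP hPF hFP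
  set Br := E * F - F * E with hBdef
  have hBE : Br * E = E * F * E := by rw [hBdef, sub_mul, mul_assoc F E E, hEE, mul_zero, sub_zero]
  have hEB : E * Br = -(E * F * E) := by rw [hBdef, mul_sub, ← mul_assoc E E F, hEE, zero_mul, zero_sub, ← mul_assoc]
  have hBF : Br * F = -(F * E * F) := by rw [hBdef, sub_mul, mul_assoc E F F, hFF, mul_zero, zero_sub, mul_assoc]
  have hFB : F * Br = F * E * F := by rw [hBdef, mul_sub, ← mul_assoc F F E, hFF, zero_mul, sub_zero, ← mul_assoc]
  -- `2P − 1 = A + B` with `A ∈ 𝔞_ℂ`, `B ∈ 𝔟_ℂ`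
  have hΘ' : (2 : ℂ) • P - 1 ∈ H.hodgeLieC := by
    simpa only [Int.cast_one, one_smul] using two_smul_gradingEnd_sub_mem_hodgeLieC H e hF hFc
  have hΘ'' : (2 : ℂ) • P - 1 ∈ spanC 𝔞 ⊔ spanC 𝔟 := by
    rw [← spanC_sup]
    rw [hodgeLieC_eq_spanC] at hΘ'
    exact spanC_mono hsum hΘ'
  obtain ⟨A, hA, B, hB, hAB⟩ := Submodule.mem_sup.1 hΘ''
  obtain ⟨c, hc⟩ := exists_coeffs_of_mem_spanC_ideal H ψ rfl e hF hFc hdeg h𝔞 hI h3 hX hXE hA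
  rw [← hP, ← hY, ← hEdef, ← hFdef, ← hBdef] at hc
  have hBEc : B * E = E * B := (commute_of_mem_spanC_of_commute hcomm hEd hB).symm
  have hBFc : B * F = F * B := (commute_of_mem_spanC_of_commute hcomm hFd hB).symm
  -- `[A, E] = 2E`, `[A, F] = −2F`
  obtain ⟨hΘE, hΘF⟩ := theta_bracket hPE hEP hPF hFP
  have hAE : A * E - E * A = (2 : ℂ) • E := by
    rw [← hΘE, ← hAB, add_mul, mul_add, hBEc]; abel
  have hAF : A * F - F * A = -((2 : ℂ) • F) := by
    rw [← hΘF, ← hAB, add_mul, mul_add, hBFc]; abel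
  -- expand
  have hAE' : c 1 • (F * E - E * F) + ((2 : ℂ) * c 2) • (E * F * E) = (2 : ℂ) • E := by
    rw [← hAE, hc]
    simp only [add_mul, mul_add, smul_mul_assoc, mul_smul_comm, hEE, hBE, hEB, smul_zero, zero_add, smul_neg]
    module
  have hAF' : c 0 • (F * E - E * F) + ((2 : ℂ) * c 2) • (F * E * F) = (2 : ℂ) • F := by
    have h2F : (2 : ℂ) • F = -(A * F - F * A) := by rw [hAF, neg_neg]
    rw [h2F, hc]
    simp only [add_mul, mul_add, smul_mul_assoc, mul_smul_comm, hFF, hBF, hFB, smul_zero, add_zero, smul_neg]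
    module
  -- `(1−P)`-corners: `c₁ = 0`, `c₀ = 0`
  set Qm : Module.End ℂ (ℂ ⊗[ℚ] V) := 1 - P with hQm
  have cFE : Qm * (F * E) * Qm = F * E := by rw [← mul_assoc Qm F E, hQF, mul_assoc F E Qm, hEQ]
  have cEF : Qm * (E * F) * Qm = 0 := by rw [← mul_assoc Qm E F, hQE, zero_mul, zero_mul]
  have cE : Qm * E * Qm = 0 := by rw [hQE, zero_mul]
  have cF : Qm * F * Qm = 0 := by rw [mul_assoc, hFQ, mul_zero]
  have cEFE : Qm * (E * F * E) * Qm = 0 := by rw [mul_assoc E F E, ← mul_assoc Qm E (F * E), hQE, zero_mul, zero_mul]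
  have cFEF : Qm * (F * E * F) * Qm = 0 := by rw [mul_assoc Qm (F * E * F) Qm, mul_assoc (F * E) F Qm, hFQ, mul_zero, mul_zero]
  have hc1 : c 1 = 0 := by
    have h := congrArg (fun T : Module.End ℂ (ℂ ⊗[ℚ] V) => Qm * T * Qm) hAE'
    simp only [smul_sub, mul_add, mul_sub, add_mul, sub_mul, mul_smul_comm, smul_mul_assoc, cFE, cEF, cE, cEFE,
      smul_zero, sub_zero, add_zero] at h
    exact (smul_eq_zero.1 h).resolve_right hFE0
  have hc0 : c 0 = 0 := by
    have h := congrArg (fun T : Module.End ℂ (ℂ ⊗[ℚ] V) => Qm * T * Qm) hAF'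
    simp only [smul_sub, mul_add, mul_sub, add_mul, sub_mul, mul_smul_comm, smul_mul_assoc, cFE, cEF, cF, cFEF,
      smul_zero, sub_zero, add_zero] at h
    exact (smul_eq_zero.1 h).resolve_right hFE0
  rw [hc1, zero_smul, zero_add] at hAE'
  rw [hc0, zero_smul, zero_add] at hAF'
  -- `c₂ ≠ 0` and `EFE = c₂⁻¹ E`, `FEF = c₂⁻¹ F`
  have hc2 : c 2 ≠ 0 := by
    intro h0
    rw [h0, mul_zero, zero_smul] at hAE'
    exact hE0 ((smul_eq_zero.1 hAE'.symm).resolve_left (two_ne_zero' ℂ))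
  have hEFE : E * F * E = (c 2)⁻¹ • E := by
    have h := congrArg (fun T : Module.End ℂ (ℂ ⊗[ℚ] V) => ((2 : ℂ) * c 2)⁻¹ • T) hAE'
    simp only [smul_smul, inv_mul_cancel₀ (mul_ne_zero (two_ne_zero' ℂ) hc2), one_smul] at h
    rw [h, mul_inv, mul_comm (2 : ℂ)⁻¹, mul_assoc, inv_mul_cancel₀ (two_ne_zero' ℂ), mul_one]
  have hFEF : F * E * F = (c 2)⁻¹ • F := by
    have h := congrArg (fun T : Module.End ℂ (ℂ ⊗[ℚ] V) => ((2 : ℂ) * c 2)⁻¹ • T) hAF'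
    simp only [smul_smul, inv_mul_cancel₀ (mul_ne_zero (two_ne_zero' ℂ) hc2), one_smul] at h
    rw [h, mul_inv, mul_comm (2 : ℂ)⁻¹, mul_assoc, inv_mul_cancel₀ (two_ne_zero' ℂ), mul_one]
  refine ⟨(c 2)⁻¹, B, inv_ne_zero hc2, hB, hEFE, hFEF, ?_⟩
  rw [inv_inv, ← hAB, hc, hc0, hc1, zero_smul, zero_smul, zero_add, zero_add]

/-! ## §4 The projector `π = α⁻¹(EF + FE)` -/

omit [Module.Finite ℚ V] [HodgeTensorFacts.{u, u}] in
/-- **Identities of `π = α⁻¹(EF + FE)`** when `E F E = αE`, `F E F = αF`, `α ≠ 0` (weight `1`, degrees in `{0,1}`, any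
rational `X`): `π² = π`, `Pπ = α⁻¹EF = πP`, `Eπ = E = πE`, `Fπ = F = πF`, `(2P − 1)π = α⁻¹[E, F] = π(2P − 1)`, and both
off-diagonal blocks `Pπ(1−P)`, `(1−P)πP` vanish (so `π` is of type `(0,0)`).  On `range π ≅ W ⊗ std` the triple
`(2P − 1, E, F)` acts as `1 ⊗ 𝔰𝔩₂`. [cite: FultonHarris1991, Lecture 11 (§11.1)] [cite: MoonenZarhin1999LowDim, §2] -/
theorem idealProjector_identities (e : Module.Basis S ℂ (ℂ ⊗[ℚ] V)) (hdeg : ∀ σ, deg σ = 0 ∨ deg σ = 1)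
    (X : Module.End ℚ V) {α : ℂ} (hα : α ≠ 0)
    (hEFE : (gradingEnd e deg * X.baseChange ℂ * (1 - gradingEnd e deg)) *
        ((1 - gradingEnd e deg) * X.baseChange ℂ * gradingEnd e deg) *
        (gradingEnd e deg * X.baseChange ℂ * (1 - gradingEnd e deg)) =
      α • (gradingEnd e deg * X.baseChange ℂ * (1 - gradingEnd e deg)))
    (hFEF : ((1 - gradingEnd e deg) * X.baseChange ℂ * gradingEnd e deg) *
        (gradingEnd e deg * X.baseChange ℂ * (1 - gradingEnd e deg)) *
        ((1 - gradingEnd e deg) * X.baseChange ℂ * gradingEnd e deg) =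
      α • ((1 - gradingEnd e deg) * X.baseChange ℂ * gradingEnd e deg))
    {Q : Module.End ℂ (ℂ ⊗[ℚ] V)}
    (hQ : Q = α⁻¹ • ((gradingEnd e deg * X.baseChange ℂ * (1 - gradingEnd e deg)) *
          ((1 - gradingEnd e deg) * X.baseChange ℂ * gradingEnd e deg) +
        ((1 - gradingEnd e deg) * X.baseChange ℂ * gradingEnd e deg) *
          (gradingEnd e deg * X.baseChange ℂ * (1 - gradingEnd e deg)))) :
    Q * Q = Q ∧ gradingEnd e deg * Q = Q * gradingEnd e deg ∧
      gradingEnd e deg * Q = α⁻¹ • ((gradingEnd e deg * X.baseChange ℂ * (1 - gradingEnd e deg)) *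
          ((1 - gradingEnd e deg) * X.baseChange ℂ * gradingEnd e deg)) ∧
      (gradingEnd e deg * X.baseChange ℂ * (1 - gradingEnd e deg)) * Q =
        gradingEnd e deg * X.baseChange ℂ * (1 - gradingEnd e deg) ∧
      Q * (gradingEnd e deg * X.baseChange ℂ * (1 - gradingEnd e deg)) =
        gradingEnd e deg * X.baseChange ℂ * (1 - gradingEnd e deg) ∧
      ((1 - gradingEnd e deg) * X.baseChange ℂ * gradingEnd e deg) * Q =
        (1 - gradingEnd e deg) * X.baseChange ℂ * gradingEnd e deg ∧
      Q * ((1 - gradingEnd e deg) * X.baseChange ℂ * gradingEnd e deg) =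
        (1 - gradingEnd e deg) * X.baseChange ℂ * gradingEnd e deg ∧
      ((2 : ℂ) • gradingEnd e deg - 1) * Q =
        α⁻¹ • ((gradingEnd e deg * X.baseChange ℂ * (1 - gradingEnd e deg)) *
            ((1 - gradingEnd e deg) * X.baseChange ℂ * gradingEnd e deg) -
          ((1 - gradingEnd e deg) * X.baseChange ℂ * gradingEnd e deg) *
            (gradingEnd e deg * X.baseChange ℂ * (1 - gradingEnd e deg))) ∧
      Q * ((2 : ℂ) • gradingEnd e deg - 1) = ((2 : ℂ) • gradingEnd e deg - 1) * Q ∧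
      gradingEnd e deg * Q * (1 - gradingEnd e deg) = 0 ∧ (1 - gradingEnd e deg) * Q * gradingEnd e deg = 0 := by
  classical
  set P := gradingEnd e deg with hP
  set Y := X.baseChange ℂ with hY
  set E := P * Y * (1 - P) with hEdef
  set F := (1 - P) * Y * P with hFdef
  have hPP : P * P = P := gradingEnd_mul_gradingEnd_of_deg e hdeg
  have hPE : P * E = E := by rw [hEdef, ← mul_assoc, ← mul_assoc, hPP]
  have hEP : E * P = 0 := by rw [hEdef, mul_assoc (P * Y) (1 - P) P, sub_mul, one_mul, hPP, sub_self, mul_zero]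
  have hPF : P * F = 0 := by
    rw [hFdef, mul_assoc (1 - P) Y P, ← mul_assoc P (1 - P) (Y * P), mul_sub, mul_one, hPP, sub_self, zero_mul]
  have hFP : F * P = F := by rw [hFdef, mul_assoc ((1 - P) * Y) P P, hPP]
  obtain ⟨hEE, hFF⟩ := SL2Triple.mul_self_eq_zero hPE hEP hPF hFP
  have hQdef : Q = α⁻¹ • (E * F + F * E) := hQ
  have h1 : E * F * (E * F) = α • (E * F) := by rw [← mul_assoc (E * F) E F, hEFE, smul_mul_assoc]
  have h2 : E * F * (F * E) = 0 := by rw [← mul_assoc (E * F) F E, mul_assoc E F F, hFF, mul_zero, zero_mul]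
  have h3 : F * E * (E * F) = 0 := by rw [← mul_assoc (F * E) E F, mul_assoc F E E, hEE, mul_zero, zero_mul]
  have h4 : F * E * (F * E) = α • (F * E) := by rw [← mul_assoc (F * E) F E, hFEF, smul_mul_assoc]
  have hQQ : Q * Q = Q := by
    calc Q * Q = (α⁻¹ * α⁻¹) • ((E * F + F * E) * (E * F + F * E)) := by rw [hQdef, smul_mul_smul_comm]
      _ = (α⁻¹ * α⁻¹) • (α • (E * F) + α • (F * E)) := by
          simp only [mul_add, add_mul, h1, h2, h3, h4, add_zero, zero_add]
      _ = Q := by rw [← smul_add, smul_smul, mul_assoc, inv_mul_cancel₀ hα, mul_one, hQdef]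
  have hPQ' : P * Q = α⁻¹ • (E * F) := by
    rw [hQdef, mul_smul_comm, mul_add, ← mul_assoc P E F, hPE, ← mul_assoc P F E, hPF, zero_mul, add_zero]
  have hQP' : Q * P = α⁻¹ • (E * F) := by
    rw [hQdef, smul_mul_assoc, add_mul, mul_assoc E F P, hFP, mul_assoc F E P, hEP, mul_zero, add_zero]
  have hPQ : P * Q = Q * P := by rw [hPQ', hQP']
  have hEQ' : E * Q = E := by
    rw [hQdef, mul_smul_comm, mul_add, ← mul_assoc E E F, hEE, zero_mul, zero_add, ← mul_assoc E F E, hEFE, smul_smul,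
      inv_mul_cancel₀ hα, one_smul]
  have hQE : Q * E = E := by
    rw [hQdef, smul_mul_assoc, add_mul, hEFE, mul_assoc F E E, hEE, mul_zero, add_zero, smul_smul, inv_mul_cancel₀ hα,
      one_smul]
  have hFQ' : F * Q = F := by
    rw [hQdef, mul_smul_comm, mul_add, ← mul_assoc F E F, hFEF, ← mul_assoc F F E, hFF, zero_mul, add_zero, smul_smul,
      inv_mul_cancel₀ hα, one_smul]
  have hQF' : Q * F = F := by
    rw [hQdef, smul_mul_assoc, add_mul, mul_assoc E F F, hFF, mul_zero, zero_add, hFEF, smul_smul, inv_mul_cancel₀ hα,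
      one_smul]
  have hΘQ : ((2 : ℂ) • P - 1) * Q = α⁻¹ • (E * F - F * E) := by
    rw [sub_mul, one_mul, smul_mul_assoc, hPQ', hQdef]
    module
  have hQΘ : Q * ((2 : ℂ) • P - 1) = ((2 : ℂ) • P - 1) * Q := by
    rw [mul_sub, sub_mul, mul_one, one_mul, mul_smul_comm, smul_mul_assoc, hPQ]
  have hoff := blocks_D hPP hPQ.symm
  exact ⟨hQQ, hPQ, hPQ', hEQ', hQE, hFQ', hQF', hΘQ, hQΘ, hoff.1, hoff.2⟩

/-- **`Dπ = D = πD` for every `D ∈ 𝔞_ℂ`** (`π = α⁻¹(EF + FE)`, `E F E = αE`, `F E F = αF`, `α ≠ 0`, `dim_ℚ 𝔞 = 3`,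
`X ∈ 𝔞 ∖ End_Hdg(V)`): `D = c₀E + c₁F + c₂[E, F]` and `E, F, [E, F]` are fixed by `π` on both sides.  So `𝔞_ℂ` acts
only on `range π` (`D = πDπ`). [cite: FultonHarris1991, Lecture 11 (§11.1)] [cite: MoonenZarhin1999LowDim, §2] -/
theorem mul_idealProjector_of_mem_spanC (H : HodgeStructure V n) (ψ : H.Polarization) (hn : n = 1)
    (e : Module.Basis S ℂ (ℂ ⊗[ℚ] V)) (hF : ∀ a, H.F a = Submodule.span ℂ (e '' {σ | a ≤ deg σ}))
    (hFc : ∀ a, complexConj (H.F a) = Submodule.span ℂ (e '' {σ | deg σ ≤ n - a}))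
    (hdeg : ∀ σ, deg σ = 0 ∨ deg σ = 1) {𝔞 : Submodule ℚ (Module.End ℚ V)} (h𝔞 : 𝔞 ≤ H.hodgeLie)
    (hI : ∀ Z ∈ H.hodgeLie, ∀ X ∈ 𝔞, Z * X - X * Z ∈ 𝔞) (h3 : Module.finrank ℚ 𝔞 = 3)
    {X : Module.End ℚ V} (hX : X ∈ 𝔞) (hXE : X ∉ H.endAlg) {α : ℂ} (hα : α ≠ 0)
    (hEFE : (gradingEnd e deg * X.baseChange ℂ * (1 - gradingEnd e deg)) *
        ((1 - gradingEnd e deg) * X.baseChange ℂ * gradingEnd e deg) *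
        (gradingEnd e deg * X.baseChange ℂ * (1 - gradingEnd e deg)) =
      α • (gradingEnd e deg * X.baseChange ℂ * (1 - gradingEnd e deg)))
    (hFEF : ((1 - gradingEnd e deg) * X.baseChange ℂ * gradingEnd e deg) *
        (gradingEnd e deg * X.baseChange ℂ * (1 - gradingEnd e deg)) *
        ((1 - gradingEnd e deg) * X.baseChange ℂ * gradingEnd e deg) =
      α • ((1 - gradingEnd e deg) * X.baseChange ℂ * gradingEnd e deg))
    {Q : Module.End ℂ (ℂ ⊗[ℚ] V)}
    (hQ : Q = α⁻¹ • ((gradingEnd e deg * X.baseChange ℂ * (1 - gradingEnd e deg)) *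
          ((1 - gradingEnd e deg) * X.baseChange ℂ * gradingEnd e deg) +
        ((1 - gradingEnd e deg) * X.baseChange ℂ * gradingEnd e deg) *
          (gradingEnd e deg * X.baseChange ℂ * (1 - gradingEnd e deg))))
    {D : Module.End ℂ (ℂ ⊗[ℚ] V)} (hD : D ∈ spanC 𝔞) : D * Q = D ∧ Q * D = D := by
  classical
  subst hn
  obtain ⟨-, -, -, hEQ', hQE, hFQ', hQF', -, -, -, -⟩ := idealProjector_identities e hdeg X hα hEFE hFEF hQ
  obtain ⟨c, hc⟩ := exists_coeffs_of_mem_spanC_ideal H ψ rfl e hF hFc hdeg h𝔞 hI h3 hX hXE hD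
  set P := gradingEnd e deg with hP
  set Y := X.baseChange ℂ with hY
  set E := P * Y * (1 - P) with hEdef
  set F := (1 - P) * Y * P with hFdef
  have hBQ : (E * F - F * E) * Q = E * F - F * E := by rw [sub_mul, mul_assoc E F Q, hFQ', mul_assoc F E Q, hEQ']
  have hQB : Q * (E * F - F * E) = E * F - F * E := by rw [mul_sub, ← mul_assoc Q E F, hQE, ← mul_assoc Q F E, hQF']
  constructor
  · rw [hc]; simp only [add_mul, smul_mul_assoc, hEQ', hFQ', hBQ]
  · rw [hc]; simp only [mul_add, mul_smul_comm, hQE, hQF', hQB]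

/-- **`D² ∈ ℂ·π` for every `D ∈ 𝔞_ℂ`** (`π = α⁻¹(EF + FE)`, `dim_ℚ 𝔞 = 3`): `D = aE + bF + c[E,F]` with `E² = F² = 0`,
`[E,F]E = αE = −E[E,F]`, `[E,F]F = −αF = −F[E,F]`, `EF + FE = απ`, `[E,F]² = α²π`, whence `D² = α(ab + αc²)π` (on
`range π ≅ W ⊗ std` every element of `𝔞_ℂ ≅ 𝔰𝔩₂` is `1 ⊗ M` with `M` trace-free, and `M² = −det M`).
[cite: FultonHarris1991, Lecture 11 (§11.1)] [cite: MoonenZarhin1999LowDim, §2] -/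
theorem sq_eq_smul_idealProjector (H : HodgeStructure V n) (ψ : H.Polarization) (hn : n = 1)
    (e : Module.Basis S ℂ (ℂ ⊗[ℚ] V)) (hF : ∀ a, H.F a = Submodule.span ℂ (e '' {σ | a ≤ deg σ}))
    (hFc : ∀ a, complexConj (H.F a) = Submodule.span ℂ (e '' {σ | deg σ ≤ n - a}))
    (hdeg : ∀ σ, deg σ = 0 ∨ deg σ = 1) {𝔞 : Submodule ℚ (Module.End ℚ V)} (h𝔞 : 𝔞 ≤ H.hodgeLie)
    (hI : ∀ Z ∈ H.hodgeLie, ∀ X ∈ 𝔞, Z * X - X * Z ∈ 𝔞) (h3 : Module.finrank ℚ 𝔞 = 3)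
    {X : Module.End ℚ V} (hX : X ∈ 𝔞) (hXE : X ∉ H.endAlg) {α : ℂ} (hα : α ≠ 0)
    (hEFE : (gradingEnd e deg * X.baseChange ℂ * (1 - gradingEnd e deg)) *
        ((1 - gradingEnd e deg) * X.baseChange ℂ * gradingEnd e deg) *
        (gradingEnd e deg * X.baseChange ℂ * (1 - gradingEnd e deg)) =
      α • (gradingEnd e deg * X.baseChange ℂ * (1 - gradingEnd e deg)))
    (hFEF : ((1 - gradingEnd e deg) * X.baseChange ℂ * gradingEnd e deg) *
        (gradingEnd e deg * X.baseChange ℂ * (1 - gradingEnd e deg)) *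
        ((1 - gradingEnd e deg) * X.baseChange ℂ * gradingEnd e deg) =
      α • ((1 - gradingEnd e deg) * X.baseChange ℂ * gradingEnd e deg))
    {Q : Module.End ℂ (ℂ ⊗[ℚ] V)}
    (hQ : Q = α⁻¹ • ((gradingEnd e deg * X.baseChange ℂ * (1 - gradingEnd e deg)) *
          ((1 - gradingEnd e deg) * X.baseChange ℂ * gradingEnd e deg) +
        ((1 - gradingEnd e deg) * X.baseChange ℂ * gradingEnd e deg) *
          (gradingEnd e deg * X.baseChange ℂ * (1 - gradingEnd e deg))))
    {D : Module.End ℂ (ℂ ⊗[ℚ] V)} (hD : D ∈ spanC 𝔞) : ∃ μ : ℂ, D * D = μ • Q := by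
  classical
  subst hn
  obtain ⟨c, hc⟩ := exists_coeffs_of_mem_spanC_ideal H ψ rfl e hF hFc hdeg h𝔞 hI h3 hX hXE hD
  set P := gradingEnd e deg with hP
  set Y := X.baseChange ℂ with hY
  set E := P * Y * (1 - P) with hEdef
  set F := (1 - P) * Y * P with hFdef
  have hPP : P * P = P := gradingEnd_mul_gradingEnd_of_deg e hdeg
  have hPE : P * E = E := by rw [hEdef, ← mul_assoc, ← mul_assoc, hPP]
  have hEP : E * P = 0 := by rw [hEdef, mul_assoc (P * Y) (1 - P) P, sub_mul, one_mul, hPP, sub_self, mul_zero]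
  have hPF : P * F = 0 := by
    rw [hFdef, mul_assoc (1 - P) Y P, ← mul_assoc P (1 - P) (Y * P), mul_sub, mul_one, hPP, sub_self, zero_mul]
  have hFP : F * P = F := by rw [hFdef, mul_assoc ((1 - P) * Y) P P, hPP]
  obtain ⟨hEE, hFF⟩ := SL2Triple.mul_self_eq_zero hPE hEP hPF hFP
  set B := E * F - F * E with hBdef
  have hsumQ : E * F + F * E = α • Q := by rw [hQ, smul_smul, mul_inv_cancel₀ hα, one_smul]
  have hBE : B * E = α • E := by rw [hBdef, sub_mul, hEFE, mul_assoc F E E, hEE, mul_zero, sub_zero]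
  have hEB : E * B = -(α • E) := by rw [hBdef, mul_sub, ← mul_assoc E E F, hEE, zero_mul, zero_sub, ← mul_assoc, hEFE]
  have hBF : B * F = -(α • F) := by rw [hBdef, sub_mul, mul_assoc E F F, hFF, mul_zero, zero_sub, hFEF]
  have hFB : F * B = α • F := by rw [hBdef, mul_sub, ← mul_assoc F F E, hFF, zero_mul, sub_zero, ← mul_assoc, hFEF]
  have hBB : B * B = (α * α) • Q := by
    have h : B * B = E * F * (E * F) - E * F * (F * E) - (F * E * (E * F) - F * E * (F * E)) := by
      rw [hBdef, sub_mul, mul_sub, mul_sub]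
    rw [h, ← mul_assoc (E * F) E F, hEFE, ← mul_assoc (E * F) F E, mul_assoc E F F, hFF, mul_zero, zero_mul, sub_zero,
      ← mul_assoc (F * E) E F, mul_assoc F E E, hEE, mul_zero, zero_mul, zero_sub, ← mul_assoc (F * E) F E, hFEF,
      smul_mul_assoc, smul_mul_assoc, sub_neg_eq_add, ← smul_add, hsumQ, smul_smul]
  refine ⟨(c 0 * c 1) * α + (c 2 * c 2) * (α * α), ?_⟩
  rw [hc]
  simp only [mul_add, add_mul, smul_mul_assoc, mul_smul_comm, hEE, hFF, hBE, hEB, hBF, hFB, hBB, smul_zero, zero_add,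
    add_zero, smul_neg]
  have hEFQ : E * F = α • Q - F * E := by rw [← hsumQ, add_sub_cancel_right]
  rw [hEFQ]
  module

/-- **An ideal `𝔞 ≤ 𝔥` not contained in `End_Hdg(V)` is not commutative** (weight `1`, effective, `ψ` a polarization):
for `X ∈ 𝔞 ∖ End_Hdg(V)` the blocks `E, F` lie in `𝔞_ℂ` (`projE_mem_spanC_of_ideal`) and `[E, F] ≠ 0`
(`commutator_projE_projF_ne_zero`), while `𝔞_ℂ` would be commutative if `𝔞` were.  Basis-free.
[cite: MoonenZarhin1999LowDim, §2] [cite: FultonHarris1991, Lecture 11 (§11.1)] -/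
theorem exists_mul_ne_mul_of_ideal (H : HodgeStructure V n) (ψ : H.Polarization) (hn : n = 1) (heff : H.IsEffective)
    {𝔞 : Submodule ℚ (Module.End ℚ V)} (h𝔞 : 𝔞 ≤ H.hodgeLie) (hI : ∀ Z ∈ H.hodgeLie, ∀ X ∈ 𝔞, Z * X - X * Z ∈ 𝔞)
    {X : Module.End ℚ V} (hX : X ∈ 𝔞) (hXE : X ∉ H.endAlg) : ∃ X₁ ∈ 𝔞, ∃ X₂ ∈ 𝔞, X₁ * X₂ ≠ X₂ * X₁ := by
  classical
  by_contra hall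
  push Not at hall
  obtain ⟨S', deg', e, hF, hFc⟩ := exists_basis_F_eq_span H
  haveI : Fintype S' := FiniteDimensional.fintypeBasisIndex e
  have hdeg : ∀ σ, deg' σ = 0 ∨ deg' σ = 1 := fun σ => by
    have h := heff.deg_mem_Icc_of_graded e hF hFc σ
    omega
  subst hn
  obtain ⟨hEd, hFd⟩ := projE_mem_spanC_of_ideal H rfl e hF hFc hdeg hI hX
  exact commutator_projE_projF_ne_zero H ψ rfl e hF hFc hdeg (h𝔞 hX) hXE
    (sub_eq_zero.2 (commute_of_mem_spanC_of_commute hall hEd hFd))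

end HodgeStructure

end Literature.AlgebraicGeometry.Motives

end
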